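import Summits.RiemannHypothesis.RiemannHypothesis.Theorems.GroundBartaGroundBartaFloorLeakageTendsto
import Summits.RiemannHypothesis.RiemannHypothesis.Theorems.GroundBartaGroundBartaFloorBartaPrelim
import Literature.NumberTheory.LFunctions.WeilGroundEnergyParitySplit
import HarnessLib

/-!
# Even-sector Barta floor — preliminaries (route `RiemannHypothesis/GroundBarta`, rung 3
`PolarPerronFrobenius`, stmt-RiemannHypothesis-18390; even-sector twin of the rung
`GroundBartaFloor`, stmt-RiemannHypothesis-18389)

The rung `GroundBartaFloor` (Theorems/GroundBartaGroundBartaFloorBarta.lean) floors the FULL window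
bottom `ε(a)` at windows carrying a one-signed ground state of the FULL form.  Its proof uses the
full form only through (i) the leakage limit `W(gₙ ⋆ κ̃) → W(u ⋆ κ̃)` along the minimising
sequence, stated there for `IsWeilGroundState a u`, and (ii) Cauchy–Schwarz for the shifted form
`Re Q − ε(b)‖·‖²` at the larger window `b = a + η`.  This file supplies the two ingredients in the
form needed by the EVEN SECTOR:

* `evenFloor_tendsto_integral_norm_mul_exp`, `evenFloor_leakageTendsto`: the weighted-`L¹`
  convergence and the leakage limit for ANY `u ∈ L²` vanishing a.e. off the window that is the
  `L²`-limit of window tests `gₙ` — no minimising property is used (the proofs of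
  `tendsto_integral_norm_mul_exp_of_minimizingSeq` / `stub_leakageTendsto`, verbatim, with the
  hypothesis `IsWeilGroundState a u` replaced by what they consume);
* `evenFloor_abs_polar_le_even`, `evenFloor_re_weilFunctional_sub_sqrt_le_even`: Cauchy–Schwarz
  for the shifted form `q_b^{ev} = Re Q − ε_ev(b)‖·‖²`, non-negative on EVEN window-`b` tests
  (`weilEvenGroundEnergy_mul_le_re`), the even twin of `ConnesVanSuijlekom.abs_polar_le` /
  `OddSector.abs_polar_le_odd` / `GroundBartaFloor.gbf_re_weilFunctional_sub_sqrt_le`.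

RH-free; elementary given the tree.
References: E. Bombieri, *Remarks on Weil's quadratic functional in the theory of prime numbers
I*, Rend. Mat. Acc. Lincei (9) 11 (2000), §4 (Problem 2, Lemma 1, Thm 3, Thm 5).
-/

set_option linter.dupNamespace false

noncomputable section

open Set MeasureTheory Filter Complex
open scoped Real Topology ComplexConjugate

namespace Summit.RiemannHypothesis.RiemannHypothesis.Theorems.PolarPerronFrobenius

open Literature.NumberTheory.LFunctions Literature.Analysis.Calculus
open Summit.RiemannHypothesis.RiemannHypothesis.Theorems.GroundStatesConvergeToXi
open Summit.RiemannHypothesis.RiemannHypothesis.Theorems.GroundBartaFloor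

/-! ## Weighted `L¹` convergence and the leakage limit, without a minimising property -/

/-- **Weighted `L¹` convergence along an `L²`-convergent sequence of window tests.** For
`u ∈ L²` vanishing a.e. off `[-a, a]` and window tests `gₙ → u` in `L²`, every exponentially
weighted `L¹` norm converges: `∫ |gₙ| e^{b|t|} → ∫ |u| e^{b|t|}` (everything lives on the compact
window, where `e^{b|t|} ≤ e^{|b| a}` and `‖·‖₁ ≤ √(2a) ‖·‖₂`).  The proof of
`tendsto_integral_norm_mul_exp_of_minimizingSeq` with `IsWeilGroundState a u` replaced by the
two facts it uses. [folklore] -/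
theorem evenFloor_tendsto_integral_norm_mul_exp {a : ℝ} {u : ℝ → ℂ} {g : ℕ → ℝ → ℂ}
    (hu2 : MemLp u 2) (hu0 : ∀ᵐ t : ℝ, t ∉ Icc (-a) a → u t = 0)
    (hg : ∀ n, IsWeilTest (g n) ∧ tsupport (g n) ⊆ Icc (-a) a)
    (hL : Tendsto (fun n => ∫ t, ‖g n t - u t‖ ^ 2) atTop (𝓝 0)) (b : ℝ) :
    Tendsto (fun n => ∫ t, ‖g n t‖ * Real.exp (b * |t|)) atTop
      (𝓝 (∫ t, ‖u t‖ * Real.exp (b * |t|))) := by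
  -- adapted from `GroundStatesConvergeToXi.tendsto_integral_norm_mul_exp_of_minimizingSeq`
  have huOn : IntegrableOn u (Icc (-a) a) := (hu2.restrict (Icc (-a) a)).integrable one_le_two
  have hui1 : Integrable u := huOn.integrable_of_ae_notMem_eq_zero hu0
  have hw : Continuous fun t : ℝ => Real.exp (b * |t|) := by fun_prop
  set M : ℝ := Real.exp (|b| * a) with hM_def
  have hM : 0 ≤ M := (Real.exp_pos _).le
  set K : ℝ := (∫ t, ‖(Icc (-a) a).indicator (fun _ => (1 : ℂ)) t‖ ^ (2 : ℝ)) ^ (1 / (2 : ℝ))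
    with hK_def
  have hg0 : ∀ n t, t ∉ Icc (-a) a → g n t = 0 := fun n t ht =>
    image_eq_zero_of_notMem_tsupport fun h' => ht ((hg n).2 h')
  have hgm : ∀ n, MemLp (g n) 2 := fun n =>
    (hg n).1.1.continuous.memLp_of_hasCompactSupport (hg n).1.2
  have hvm : ∀ n, MemLp (fun t => g n t - u t) 2 := fun n => (hgm n).sub hu2
  have hv0 : ∀ n, ∀ᵐ t : ℝ, t ∉ Icc (-a) a → g n t - u t = 0 := fun n =>
    hu0.mono fun t ht hts => by simp [hg0 n t hts, ht hts]
  have hvi : ∀ n, Integrable (fun t => g n t - u t) := fun n =>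
    ((hg n).1.1.continuous.integrable_of_hasCompactSupport (hg n).1.2).sub hui1
  have hgi : ∀ n, Integrable (fun t => ‖g n t‖ * Real.exp (b * |t|)) := fun n =>
    ((hg n).1.1.continuous.norm.mul hw).integrable_of_hasCompactSupport
      (hg n).1.2.norm.mul_right
  have hui : Integrable (fun t => ‖u t‖ * Real.exp (b * |t|)) :=
    (IntegrableOn.mul_continuousOn huOn.norm hw.continuousOn
      isCompact_Icc).integrable_of_ae_notMem_eq_zero
        (hu0.mono fun t ht hts => by simp [ht hts])
  have hkey : ∀ n, ‖(∫ t, ‖g n t‖ * Real.exp (b * |t|)) - ∫ t, ‖u t‖ * Real.exp (b * |t|)‖ ≤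
      M * (Real.sqrt (∫ t, ‖g n t - u t‖ ^ 2) * K) := fun n => by
    rw [← integral_sub (hgi n) hui]
    calc ‖∫ t, (‖g n t‖ * Real.exp (b * |t|) - ‖u t‖ * Real.exp (b * |t|))‖
        ≤ ∫ t, M * ‖g n t - u t‖ := by
          refine norm_integral_le_of_norm_le ((hvi n).norm.const_mul M) ?_
          filter_upwards [hu0] with t ht
          by_cases hmem : t ∈ Icc (-a) a
          · rw [← sub_mul, norm_mul, Real.norm_eq_abs, Real.norm_eq_abs,
              abs_of_pos (Real.exp_pos _), mul_comm M]
            exact mul_le_mul (abs_norm_sub_norm_le _ _) (weightedL1_exp_le_of_mem_Icc hmem)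
              (Real.exp_pos _).le (norm_nonneg _)
          · simp [hg0 n t hmem, ht hmem]
      _ = M * ∫ t, ‖g n t - u t‖ := integral_const_mul _ _
      _ ≤ M * (Real.sqrt (∫ t, ‖g n t - u t‖ ^ 2) * K) :=
          mul_le_mul_of_nonneg_left (weightedL1_integral_norm_le_sqrt (hvm n) (hv0 n)) hM
  rw [tendsto_iff_norm_sub_tendsto_zero]
  refine squeeze_zero (fun n => norm_nonneg _) hkey ?_
  have hlim : Tendsto (fun n => M * (Real.sqrt (∫ t, ‖g n t - u t‖ ^ 2) * K)) atTop
      (𝓝 (M * (Real.sqrt 0 * K))) :=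
    (hL.sqrt.mul_const K).const_mul M
  simpa only [Real.sqrt_zero, zero_mul, mul_zero] using hlim

/-- **The leakage functional passes to the limit along an `L²`-convergent sequence of window
tests** (no minimising property): for `u ∈ L²` vanishing a.e. off `[-a, a]`, window tests
`gₙ → u` in `L²` and a kernel `κ` of the strong exponential class (smooth, every derivative
`O(e^{-|t|})`), `W(gₙ ⋆ κ̃) → W(u ⋆ κ̃)`.  The proof of `GroundBartaFloor.stub_leakageTendsto`
verbatim (common envelope `C e^{-|t|}` on `gₙ ⋆ κ̃` and two derivatives from the bounded weighted
norms, pointwise convergence by the `L²` pairing with the translates of `κ`, dominated convergence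
of the Weil functional on the exponential class). [folklore] -/
theorem evenFloor_leakageTendsto {a : ℝ} {u : ℝ → ℂ} {g : ℕ → ℝ → ℂ} {κ : ℝ → ℂ}
    (hu2 : MemLp u 2) (hu0 : ∀ᵐ t : ℝ, t ∉ Icc (-a) a → u t = 0)
    (hg : ∀ n, IsWeilTest (g n) ∧ tsupport (g n) ⊆ Icc (-a) a)
    (hL : Tendsto (fun n => ∫ t, ‖g n t - u t‖ ^ 2) atTop (𝓝 0))
    (hκ : ContDiff ℝ (⊤ : ℕ∞) κ)
    (hκb : ∀ k : ℕ, ∃ C : ℝ, ∀ t : ℝ, ‖iteratedDeriv k κ t‖ ≤ C * Real.exp (-(1 * |t|))) :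
    Tendsto (fun n => weilFunctional (weilConv (g n) (weilReflect κ))) atTop
      (𝓝 (weilFunctional (weilConv u (weilReflect κ)))) := by
  -- adapted from `GroundBartaFloor.stub_leakageTendsto`
  obtain ⟨hrc, hrb, hrbdd⟩ := leakTendsto_reflect_class hκ hκb
  set F : ℕ → ℝ → ℂ := fun n => weilConv (g n) (weilReflect κ) with hF
  set G : ℝ → ℂ := weilConv u (weilReflect κ) with hG
  have huOn : IntegrableOn u (Icc (-a) a) := (hu2.restrict (Icc (-a) a)).integrable one_le_two
  have hui1 : Integrable u := huOn.integrable_of_ae_notMem_eq_zero hu0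
  have hgm : ∀ n, MemLp (g n) 2 := fun n => ConnesVanSuijlekom.isWeilTest_memLp (hg n).1
  have hgi1 : ∀ n, Integrable (g n) := fun n =>
    (hg n).1.1.continuous.integrable_of_hasCompactSupport (hg n).1.2
  have hgi : ∀ n, Integrable (fun t : ℝ => ‖g n t‖ * Real.exp (1 * |t|)) := fun n =>
    integrable_norm_mul_exp_of_isWeilTest (hg n).1 1
  obtain ⟨B, hB⟩ := (evenFloor_tendsto_integral_norm_mul_exp hu2 hu0 hg hL 1).bddAbove_range
  have hBn : ∀ n, (∫ t, ‖g n t‖ * Real.exp (1 * |t|)) ≤ B := fun n => hB ⟨n, rfl⟩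
  have hB0 : 0 ≤ B := (integral_nonneg fun t => by positivity).trans (hBn 0)
  obtain ⟨C₀, hC₀0, hC₀⟩ := hrb 0
  obtain ⟨C₁, hC₁0, hC₁⟩ := hrb 1
  obtain ⟨C₂, hC₂0, hC₂⟩ := hrb 2
  set C : ℝ := max C₀ (max C₁ C₂) * B with hC
  have henv : ∀ (j : ℕ) (Cj : ℝ), 0 ≤ Cj → Cj ≤ max C₀ (max C₁ C₂) →
      (∀ t, ‖iteratedDeriv j (weilReflect κ) t‖ ≤ Cj * Real.exp (-(1 * |t|))) →
      ∀ n t, ‖iteratedDeriv j (F n) t‖ ≤ C * Real.exp (-(1 * |t|)) := by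
    intro j Cj hCj0 hCjle hCj n t
    rw [hF]
    dsimp only
    rw [scPair_iteratedDeriv_eq (hgi1 n) hrc hrbdd j]
    have h1 := scPair_norm_weilConv_le (v := g n) (k := iteratedDeriv j (weilReflect κ))
      (hgi n) zero_le_one le_rfl hCj t
    rw [max_eq_left hCj0] at h1
    refine h1.trans (mul_le_mul_of_nonneg_right ?_ (Real.exp_pos _).le)
    rw [hC]
    exact mul_le_mul hCjle (hBn n) (integral_nonneg fun s => by positivity)
      (hCj0.trans hCjle)
  have hFs : ∀ n, ContDiff ℝ (⊤ : ℕ∞) (F n) := fun n => scPair_contDiff (hgi1 n) hrc hrbdd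
  have hF0 : ∀ n t, ‖F n t‖ ≤ C * Real.exp (-(1 * |t|)) := fun n t => by
    have h := henv 0 C₀ hC₀0 (le_max_left _ _) hC₀ n t
    rwa [iteratedDeriv_zero] at h
  have hF1 : ∀ n t, ‖deriv (F n) t‖ ≤ C * Real.exp (-(1 * |t|)) := fun n t => by
    have h := henv 1 C₁ hC₁0 ((le_max_left _ _).trans (le_max_right _ _)) hC₁ n t
    rwa [iteratedDeriv_one] at h
  have hF2 : ∀ n t, ‖deriv (deriv (F n)) t‖ ≤ C * Real.exp (-(1 * |t|)) := fun n t => by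
    have h := henv 2 C₂ hC₂0 ((le_max_right _ _).trans (le_max_right _ _)) hC₂ n t
    rwa [iteratedDeriv_succ, iteratedDeriv_one] at h
  have hGc : Continuous G := (scPair_contDiff hui1 hrc hrbdd).continuous
  obtain ⟨K, hK⟩ := hκb 0
  have hK' : ∀ t : ℝ, ‖κ t‖ ≤ K * Real.exp (-(1 * |t|)) := fun t => by
    simpa only [iteratedDeriv_zero] using hK t
  have hpt : ∀ t, Tendsto (fun n => F n t) atTop (𝓝 (G t)) := fun t =>
    leakTendsto_pointwise hgm hu2 hL hκ.continuous hK' t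
  exact tendsto_weilFunctional_of_dominated (by norm_num : (1 : ℝ) / 2 < 1) hFs hGc hF0 hF1 hF2 hpt

/-! ## Cauchy–Schwarz for the shifted form in the even sector -/

/-- Sums of even functions with real multiples of even functions are even. [folklore] -/
theorem evenFloor_even_add_real_mul {f h : ℝ → ℂ} (hfe : ∀ t, f (-t) = f t)
    (hhe : ∀ t, h (-t) = h t) (s : ℝ) :
    ∀ t, (f + fun x => (s : ℂ) * h x) (-t) = (f + fun x => (s : ℂ) * h x) t := by
  intro t
  simp only [Pi.add_apply, hfe t, hhe t]

/-- **Cauchy–Schwarz for the shifted form on the even sector.** For EVEN test functions `f, h`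
on the window `[-a, a]` put `q(φ) := Re Q(φ) − ε_ev(a)∫|φ|²` (`≥ 0` on even window tests,
`weilEvenGroundEnergy_mul_le_re`). Then `|q(f + h) − q(f) − q(h)| ≤ 2 √q(f) √q(h)`: the real
polynomial `t ↦ q(f + t h) ≥ 0` (each `f + t h` is an even window test) has non-positive
discriminant. (Even twin of `OddSector.abs_polar_le_odd`.)
[cite: Bombieri2000Weil, §4 Problem 2, Thm 3 (proof) and Thm 5] -/
theorem evenFloor_abs_polar_le_even {a : ℝ} {f h : ℝ → ℂ} (hf : IsWeilTest f)
    (hfs : tsupport f ⊆ Icc (-a) a) (hfe : ∀ t, f (-t) = f t) (hh : IsWeilTest h)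
    (hhs : tsupport h ⊆ Icc (-a) a) (hhe : ∀ t, h (-t) = h t) :
    |((weilQuadratic (f + h)).re - weilEvenGroundEnergy a * ∫ x, ‖(f + h) x‖ ^ 2) -
        ((weilQuadratic f).re - weilEvenGroundEnergy a * ∫ x, ‖f x‖ ^ 2) -
        ((weilQuadratic h).re - weilEvenGroundEnergy a * ∫ x, ‖h x‖ ^ 2)| ≤
      2 * Real.sqrt ((weilQuadratic f).re - weilEvenGroundEnergy a * ∫ x, ‖f x‖ ^ 2) *
        Real.sqrt ((weilQuadratic h).re - weilEvenGroundEnergy a * ∫ x, ‖h x‖ ^ 2) := by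
  -- adapted from `OddSector.abs_polar_le_odd`, ε_od ↦ ε_ev
  set e := weilEvenGroundEnergy a with he
  set qf := (weilQuadratic f).re - e * ∫ x, ‖f x‖ ^ 2 with hqf
  set qh := (weilQuadratic h).re - e * ∫ x, ‖h x‖ ^ 2 with hqh
  set X := (weilFunctional (weilConv f (weilReflect h)) +
    weilFunctional (weilConv h (weilReflect f))).re with hX
  set P := (∫ x, f x * conj (h x)).re with hP
  set ρ := X - 2 * e * P with hρ
  have hqf0 : 0 ≤ qf := by
    have := weilEvenGroundEnergy_mul_le_re hf hfs hfe
    simp only [hqf]; linarith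
  have hqh0 : 0 ≤ qh := by
    have := weilEvenGroundEnergy_mul_le_re hh hhs hhe
    simp only [hqh]; linarith
  have hline : ∀ t : ℝ,
      (weilQuadratic (f + fun x => (t : ℂ) * h x)).re -
          e * ∫ x, ‖(f + fun x => (t : ℂ) * h x) x‖ ^ 2 =
        qf + t ^ 2 * qh + t * ρ := by
    intro t
    rw [ConnesVanSuijlekom.re_weilQuadratic_add_real_mul hf hh t,
      ConnesVanSuijlekom.integral_norm_sq_add_real_mul hf hh t]
    simp only [hqf, hqh, hρ, hX, hP]
    ring
  have hnonneg : ∀ t : ℝ, 0 ≤ qh * (t * t) + ρ * t + qf := by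
    intro t
    have ht : IsWeilTest (f + fun x => (t : ℂ) * h x) := hf.add (hh.const_mul t)
    have hts : tsupport (f + fun x => (t : ℂ) * h x) ⊆ Icc (-a) a :=
      (tsupport_add _ _).trans (union_subset hfs (tsupport_mul_subset_right.trans hhs))
    have h0 := weilEvenGroundEnergy_mul_le_re ht hts (evenFloor_even_add_real_mul hfe hhe t)
    have h1 := hline t
    nlinarith [h0, h1]
  have hdisc : discrim qh ρ qf ≤ 0 := discrim_le_zero hnonneg
  rw [discrim] at hdisc
  have hone : (f + fun x => ((1 : ℝ) : ℂ) * h x) = f + h := by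
    funext x; simp
  have h1 := hline 1
  rw [hone] at h1
  have hval : ((weilQuadratic (f + h)).re - e * ∫ x, ‖(f + h) x‖ ^ 2) - qf - qh = ρ := by
    rw [h1]; ring
  rw [hval]
  have hρ2 : ρ ^ 2 ≤ (2 * Real.sqrt qf * Real.sqrt qh) ^ 2 := by
    rw [mul_pow, mul_pow, Real.sq_sqrt hqf0, Real.sq_sqrt hqh0]
    nlinarith [hdisc]
  exact abs_le_of_sq_le_sq' hρ2 (by positivity) |>.elim (fun h1 h2 => abs_le.2 ⟨h1, h2⟩)

/-- **Cauchy–Schwarz for the shifted form at the window `b`, even sector**: for EVEN tests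
`f, h` supported in `[-b, b]`,
`Re W(f ⋆ h̃) - √q_b(f) √q_b(h) ≤ ε_ev(b) Re⟨f, h⟩`, `q_b(φ) = Re Q(φ) - ε_ev(b)‖φ‖²`
(`evenFloor_abs_polar_le_even` + hermitian symmetry; even twin of
`GroundBartaFloor.gbf_re_weilFunctional_sub_sqrt_le`). [folklore] -/
theorem evenFloor_re_weilFunctional_sub_sqrt_le_even {b : ℝ} {f h : ℝ → ℂ} (hf : IsWeilTest f)
    (hfs : tsupport f ⊆ Icc (-b) b) (hfe : ∀ t, f (-t) = f t) (hh : IsWeilTest h)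
    (hhs : tsupport h ⊆ Icc (-b) b) (hhe : ∀ t, h (-t) = h t) :
    (weilFunctional (weilConv f (weilReflect h))).re -
        Real.sqrt ((weilQuadratic f).re - weilEvenGroundEnergy b * ∫ x, ‖f x‖ ^ 2) *
          Real.sqrt ((weilQuadratic h).re - weilEvenGroundEnergy b * ∫ x, ‖h x‖ ^ 2) ≤
      weilEvenGroundEnergy b * (∫ t, f t * conj (h t)).re := by
  -- adapted from `GroundBartaFloor.gbf_re_weilFunctional_sub_sqrt_le`, ε ↦ ε_ev
  set ε := weilEvenGroundEnergy b with hε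
  have hcs := evenFloor_abs_polar_le_even hf hfs hfe hh hhs hhe
  have e1 := ConnesVanSuijlekom.re_weilQuadratic_add_real_mul hf hh 1
  have e2 := ConnesVanSuijlekom.integral_norm_sq_add_real_mul hf hh 1
  have hone : (f + fun x => ((1 : ℝ) : ℂ) * h x) = f + h := by
    funext x
    simp
  rw [hone] at e1 e2
  have key : ((weilQuadratic (f + h)).re - ε * ∫ x, ‖(f + h) x‖ ^ 2) -
      ((weilQuadratic f).re - ε * ∫ x, ‖f x‖ ^ 2) -
      ((weilQuadratic h).re - ε * ∫ x, ‖h x‖ ^ 2) =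
      2 * ((weilFunctional (weilConv f (weilReflect h))).re - ε * (∫ t, f t * conj (h t)).re) := by
    rw [e1, e2, weilFunctional_weilConv_weilReflect_swap f h]
    simp only [Complex.add_re, Complex.conj_re]
    ring
  rw [key] at hcs
  have h2 := (abs_le.1 hcs).2
  nlinarith [h2, Real.sqrt_nonneg ((weilQuadratic f).re - ε * ∫ x, ‖f x‖ ^ 2),
    Real.sqrt_nonneg ((weilQuadratic h).re - ε * ∫ x, ‖h x‖ ^ 2)]

end Summit.RiemannHypothesis.RiemannHypothesis.Theorems.PolarPerronFrobenius

end
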